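import Summits.QuantumFields.YangMills.Theorems.LuscherReductionDressedRitzPolyakovLiftStaticsSymmetry
import HarnessLib

/-!
# Line «polyakovlift» on crux `DressedRitz` (stmt-QuantumFields-20205), stub S-STAT `stub_liftStatics`: symmetry zeros of clause (o2), II —
# DOUBLETS: inside an `S₃`-doublet the covariance matrix of the flowed insertions is EXACTLY scalar (every basis of the doublet)

Fleet-service module of seat ym-infvol-p1 g5 (route `LuscherReduction`, femto rung R2b1).  Companion of `…PolyakovLiftStaticsSymmetry.lean`
(p528682: the covariance form `(f, h) ↦ ⟨u_f, u_h⟩`, `u_f = OpPlat.ins φ (flowLiftAt 0 t f)`, is invariant under one-site axis permutations for every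
raw vacuum; zeros between the two one-dimensional `S₃`-classes and their complements).  This file treats the TWO-DIMENSIONAL class: a pair of
one-site functions `(f₁, f₂)` on which some axis permutation `c` acts by a genuine rotation,
`f₁∘P_c = cs·f₁ + sn·f₂`, `f₂∘P_c = −sn·f₁ + cs·f₂`, `cs² + sn² = 1`, `sn ≠ 0` (the 3-cycle on an `E`-doublet of `S₃`: `cs = −1/2`, `sn = ±√3/2`,
in ANY orthonormal basis of the doublet).  Schur's lemma in its smallest instance — a symmetric `2 × 2` matrix commuting with a non-trivial
rotation is scalar — gives:

* §1 `ins_flowLiftAt_lincomb`, `cov_lincomb_left`, `cov_lincomb_right` — the channel map `f ↦ u_f` is linear and the covariance form bilinear;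
* §2 ★ `cov_doublet_eq_zero`, `var_doublet_eq` — `⟨u_{f₁}, u_{f₂}⟩ = 0` and `‖u_{f₁}‖² = ‖u_{f₂}‖²` EXACTLY, for every raw vacuum, flow time, `L`, `β`;
* §3 `liftFamily_o2_of_doublet` — clause (o2) with ANY `C ≥ 0` for two channels of a lift basis forming such a doublet — answering, for S-STAT, the
  disprover's «rotation inside exactly degenerate one-site multiplets» hazard (cdisprove-20205-1 g0): inside an `E`-doublet NO basis choice can
  violate (o2).  Together with p528682: the open content of (o2) is confined to pairs drawn from two DIFFERENT levels of the same `S₃`-type.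

HONEST FRAMING: exact symmetry bookkeeping at fixed lattice on the CONDITIONAL femto rung R2b1; nothing about the renormalisation-group estimate
for same-type pairs; nothing here bears on infinite volume, the continuum limit or the Clay gap.  References: M. Lüscher, NPB 219 (1983) 233, §2
[cite: Luscher1983, §2]; M. Lüscher, U. Wolff, NPB 339 (1990) 222 [cite: LuscherWolff1990].
-/

set_option autoImplicit false

noncomputable section

open MeasureTheory Filter Topology
open Literature.MathematicalPhysics.QuantumFieldTheory
open Literature.MathematicalPhysics.QuantumLattice
open scoped BigOperators

namespace Summit.QuantumFields.YangMills.Theorems.FemtoTransferGap.PolyakovLift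

open Summit.QuantumFields.YangMills.Theorems.FemtoTransferGap

/-! ## §1 Linearity of the channel map and bilinearity of the covariance form -/

section Linear

variable {L : ℕ} [NeZero L]

/-- The flowed lift of a linear combination is the linear combination of the flowed lifts (evaluation at `Π_t U`). [folklore] -/
theorem flowLiftAt_lincomb (x₀ : Site 3 L) (t : ℝ) (a b : ℝ) (f h : GaugeConfig 3 1 SU2 → ℝ) :
    flowLiftAt x₀ t (fun V => a * f V + b * h V) = a • flowLiftAt x₀ t f + b • flowLiftAt x₀ t h := by
  funext U; simp only [flowLiftAt, Pi.add_apply, Pi.smul_apply, smul_eq_mul]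

/-- **The channel map `O ↦ OpPlat.ins φ O` is linear** on physical insertions: `ins φ (aO + bO') = a·ins φ O + b·ins φ O'` (the subtracted
vacuum expectation is linear). [folklore] -/
theorem ins_lincomb {φ O O' : GaugeConfig 3 L SU2 → ℝ} (hφ : IsPhys φ) (hO : IsPhys O) (hO' : IsPhys O') (a b : ℝ) :
    OpPlat.ins φ (a • O + b • O') = a • OpPlat.ins φ O + b • OpPlat.ins φ O' := by
  have hvev : l2 φ ((a • O + b • O') * φ) = a * l2 φ (O * φ) + b * l2 φ (O' * φ) := by
    have hsplit : (a • O + b • O') * φ = a • (O * φ) + b • (O' * φ) := by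
      funext U; simp only [Pi.mul_apply, Pi.add_apply, Pi.smul_apply, smul_eq_mul]; ring
    rw [hsplit, l2_comm, l2_add_left ((OpPlat.isPhys_mul hO hφ).smul a) ((OpPlat.isPhys_mul hO' hφ).smul b) hφ, l2_smul_left, l2_smul_left,
      l2_comm (O * φ), l2_comm (O' * φ)]
  funext U
  simp only [OpPlat.ins, hvev, Pi.mul_apply, Pi.sub_apply, Pi.add_apply, Pi.smul_apply, smul_eq_mul]
  ring

/-- Linearity of `f ↦ u_f = OpPlat.ins φ (flowLiftAt x₀ t f)` in the one-site function. [folklore] -/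
theorem ins_flowLiftAt_lincomb {φ : GaugeConfig 3 L SU2 → ℝ} (hφ : IsPhys φ) (x₀ : Site 3 L) (t : ℝ) (a b : ℝ)
    {f h : GaugeConfig 3 1 SU2 → ℝ} (hf : IsPhys f) (hh : IsPhys h) :
    OpPlat.ins φ (flowLiftAt x₀ t fun V => a * f V + b * h V) =
      a • OpPlat.ins φ (flowLiftAt x₀ t f) + b • OpPlat.ins φ (flowLiftAt x₀ t h) := by
  rw [flowLiftAt_lincomb, ins_lincomb hφ (isPhys_flowLiftAt x₀ t hf) (isPhys_flowLiftAt x₀ t hh)]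

/-- Bilinearity of `l2` against a fixed physical vector, linear-combination form (left slot). [folklore] -/
theorem l2_lincomb_left' {ψ ψ' χ : GaugeConfig 3 L SU2 → ℝ} (hψ : IsPhys ψ) (hψ' : IsPhys ψ') (hχ : IsPhys χ) (a b : ℝ) :
    l2 (a • ψ + b • ψ') χ = a * l2 ψ χ + b * l2 ψ' χ := by
  rw [l2_add_left (hψ.smul a) (hψ'.smul b) hχ, l2_smul_left, l2_smul_left]

/-- **The covariance form is linear in the first one-site function.** [folklore] -/
theorem cov_lincomb_left {φ : GaugeConfig 3 L SU2 → ℝ} (hφ : IsPhys φ) (t : ℝ) (a b : ℝ)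
    {f h e : GaugeConfig 3 1 SU2 → ℝ} (hf : IsPhys f) (hh : IsPhys h) (he : IsPhys e) :
    l2 (OpPlat.ins φ (flowLiftAt 0 t fun V => a * f V + b * h V)) (OpPlat.ins φ (flowLiftAt 0 t e)) =
      a * l2 (OpPlat.ins φ (flowLiftAt 0 t f)) (OpPlat.ins φ (flowLiftAt 0 t e)) +
        b * l2 (OpPlat.ins φ (flowLiftAt 0 t h)) (OpPlat.ins φ (flowLiftAt 0 t e)) := by
  rw [ins_flowLiftAt_lincomb hφ 0 t a b hf hh]
  exact l2_lincomb_left' (OpPlat.isPhys_ins hφ (isPhys_flowLiftAt 0 t hf)) (OpPlat.isPhys_ins hφ (isPhys_flowLiftAt 0 t hh))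
    (OpPlat.isPhys_ins hφ (isPhys_flowLiftAt 0 t he)) a b

/-- **The covariance form is linear in the second one-site function.** [folklore] -/
theorem cov_lincomb_right {φ : GaugeConfig 3 L SU2 → ℝ} (hφ : IsPhys φ) (t : ℝ) (a b : ℝ)
    {f h e : GaugeConfig 3 1 SU2 → ℝ} (hf : IsPhys f) (hh : IsPhys h) (he : IsPhys e) :
    l2 (OpPlat.ins φ (flowLiftAt 0 t e)) (OpPlat.ins φ (flowLiftAt 0 t fun V => a * f V + b * h V)) =
      a * l2 (OpPlat.ins φ (flowLiftAt 0 t e)) (OpPlat.ins φ (flowLiftAt 0 t f)) +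
        b * l2 (OpPlat.ins φ (flowLiftAt 0 t e)) (OpPlat.ins φ (flowLiftAt 0 t h)) := by
  rw [l2_comm, cov_lincomb_left hφ t a b hf hh he, l2_comm (OpPlat.ins φ (flowLiftAt 0 t f)), l2_comm (OpPlat.ins φ (flowLiftAt 0 t h))]

end Linear

/-! ## §2 ★ Inside a rotating doublet the covariance matrix is scalar -/

section Doublet

variable {L : ℕ} [NeZero L]

/-- ★ **DOUBLET LEMMA (Schur, `2 × 2`).**  Let `φ` be a raw vacuum and `f₁, f₂` physical one-site functions on which some axis permutation `c`
acts by a rotation: `f₁∘P_c = cs·f₁ + sn·f₂`, `f₂∘P_c = −sn·f₁ + cs·f₂`, `cs² + sn² = 1`, `sn ≠ 0`.  Then the flowed insertions are EXACTLY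
uncorrelated and have EQUAL norms: `⟨u_{f₁}, u_{f₂}⟩ = 0` and `‖u_{f₁}‖² = ‖u_{f₂}‖²` (the covariance matrix `M` of the pair satisfies `RᵀMR = M`
for the rotation `R`, `l2_ins_flowLiftAt_comp_configPerm`; a symmetric matrix commuting with a rotation of angle `∉ {0, π}` is scalar).
[cite: Luscher1983, §2] [cite: LuscherWolff1990] -/
theorem cov_doublet_eq_zero_and_var_eq (β : ℝ) {φ : GaugeConfig 3 L SU2 → ℝ} (hφ : IsPhys φ) (hφ1 : l2 φ φ = 1)
    (heig : transferApply β φ = levelValue su2Rep L β 0 • φ) (t : ℝ) {f₁ f₂ : GaugeConfig 3 1 SU2 → ℝ} (hf₁ : IsPhys f₁) (hf₂ : IsPhys f₂)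
    (c : Equiv.Perm (Fin 3)) {cs sn : ℝ} (hrot : cs ^ 2 + sn ^ 2 = 1) (hsn : sn ≠ 0)
    (h₁ : (fun V => f₁ (configPerm c V)) = fun V => cs * f₁ V + sn * f₂ V)
    (h₂ : (fun V => f₂ (configPerm c V)) = fun V => -sn * f₁ V + cs * f₂ V) :
    l2 (OpPlat.ins φ (flowLiftAt 0 t f₁)) (OpPlat.ins φ (flowLiftAt 0 t f₂)) = 0 ∧
      l2 (OpPlat.ins φ (flowLiftAt 0 t f₁)) (OpPlat.ins φ (flowLiftAt 0 t f₁)) =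
        l2 (OpPlat.ins φ (flowLiftAt 0 t f₂)) (OpPlat.ins φ (flowLiftAt 0 t f₂)) := by
  have hu₁ : IsPhys (OpPlat.ins φ (flowLiftAt (L := L) 0 t f₁)) := OpPlat.isPhys_ins hφ (isPhys_flowLiftAt 0 t hf₁)
  have hu₂ : IsPhys (OpPlat.ins φ (flowLiftAt (L := L) 0 t f₂)) := OpPlat.isPhys_ins hφ (isPhys_flowLiftAt 0 t hf₂)
  have hrf : IsPhys fun V => cs * f₁ V + sn * f₂ V := by
    have : (fun V => cs * f₁ V + sn * f₂ V) = cs • f₁ + sn • f₂ := by funext V; simp [smul_eq_mul]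
    rw [this]; exact (hf₁.smul cs).add (hf₂.smul sn)
  have hrg : IsPhys fun V => -sn * f₁ V + cs * f₂ V := by
    have : (fun V => -sn * f₁ V + cs * f₂ V) = (-sn) • f₁ + cs • f₂ := by funext V; simp [smul_eq_mul]
    rw [this]; exact (hf₁.smul (-sn)).add (hf₂.smul cs)
  -- invariance of the form under `c`, expanded by bilinearity
  have e1 := (l2_ins_flowLiftAt_comp_configPerm β hφ hφ1 heig c t hf₁ hf₁).symm
  rw [h₁, cov_lincomb_left hφ t cs sn hf₁ hf₂ hrf, cov_lincomb_right hφ t cs sn hf₁ hf₂ hf₁,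
    cov_lincomb_right hφ t cs sn hf₁ hf₂ hf₂] at e1
  have e2 := (l2_ins_flowLiftAt_comp_configPerm β hφ hφ1 heig c t hf₁ hf₂).symm
  rw [h₁, h₂, cov_lincomb_left hφ t cs sn hf₁ hf₂ hrg, cov_lincomb_right hφ t (-sn) cs hf₁ hf₂ hf₁,
    cov_lincomb_right hφ t (-sn) cs hf₁ hf₂ hf₂] at e2
  rw [l2_comm (OpPlat.ins φ (flowLiftAt 0 t f₂)) (OpPlat.ins φ (flowLiftAt 0 t f₁))] at e1 e2
  -- the three entries of the covariance matrix
  set A : ℝ := l2 (OpPlat.ins φ (flowLiftAt (L := L) 0 t f₁)) (OpPlat.ins φ (flowLiftAt 0 t f₁)) with hA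
  set B : ℝ := l2 (OpPlat.ins φ (flowLiftAt (L := L) 0 t f₁)) (OpPlat.ins φ (flowLiftAt 0 t f₂)) with hB
  set D : ℝ := l2 (OpPlat.ins φ (flowLiftAt (L := L) 0 t f₂)) (OpPlat.ins φ (flowLiftAt 0 t f₂)) with hD
  -- Schur, by hand: `sn·(A − D) = 2cs·B` and `2sn·B = −cs·(A − D)` force `B = 0`, `A = D`
  have h3 : sn * (sn * (A - D) - 2 * cs * B) = 0 := by linear_combination e1 + A * hrot
  have h4 : sn * (A - D) - 2 * cs * B = 0 := (mul_eq_zero.mp h3).resolve_left hsn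
  have h5 : sn * (2 * sn * B + cs * (A - D)) = 0 := by linear_combination e2 + B * hrot
  have h6 : 2 * sn * B + cs * (A - D) = 0 := (mul_eq_zero.mp h5).resolve_left hsn
  have hB0 : B = 0 := by
    have h7 : 2 * B * (sn ^ 2 + cs ^ 2) = 0 := by linear_combination sn * h6 - cs * h4
    have h8 : sn ^ 2 + cs ^ 2 = 1 := by linarith
    rw [h8, mul_one] at h7
    linarith
  have hAD : A = D := by
    have h9 : sn * (A - D) = 0 := by linear_combination h4 + 2 * cs * hB0
    have := (mul_eq_zero.mp h9).resolve_left hsn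
    linarith
  exact ⟨hB0, hAD⟩

/-- ★ Doublet partners are exactly uncorrelated. [cite: Luscher1983, §2] -/
theorem cov_doublet_eq_zero (β : ℝ) {φ : GaugeConfig 3 L SU2 → ℝ} (hφ : IsPhys φ) (hφ1 : l2 φ φ = 1)
    (heig : transferApply β φ = levelValue su2Rep L β 0 • φ) (t : ℝ) {f₁ f₂ : GaugeConfig 3 1 SU2 → ℝ} (hf₁ : IsPhys f₁) (hf₂ : IsPhys f₂)
    (c : Equiv.Perm (Fin 3)) {cs sn : ℝ} (hrot : cs ^ 2 + sn ^ 2 = 1) (hsn : sn ≠ 0)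
    (h₁ : (fun V => f₁ (configPerm c V)) = fun V => cs * f₁ V + sn * f₂ V)
    (h₂ : (fun V => f₂ (configPerm c V)) = fun V => -sn * f₁ V + cs * f₂ V) :
    l2 (OpPlat.ins φ (flowLiftAt 0 t f₁)) (OpPlat.ins φ (flowLiftAt 0 t f₂)) = 0 :=
  (cov_doublet_eq_zero_and_var_eq β hφ hφ1 heig t hf₁ hf₂ c hrot hsn h₁ h₂).1

/-- ★ Doublet partners have equal norms (variances). [cite: Luscher1983, §2] -/
theorem var_doublet_eq (β : ℝ) {φ : GaugeConfig 3 L SU2 → ℝ} (hφ : IsPhys φ) (hφ1 : l2 φ φ = 1)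
    (heig : transferApply β φ = levelValue su2Rep L β 0 • φ) (t : ℝ) {f₁ f₂ : GaugeConfig 3 1 SU2 → ℝ} (hf₁ : IsPhys f₁) (hf₂ : IsPhys f₂)
    (c : Equiv.Perm (Fin 3)) {cs sn : ℝ} (hrot : cs ^ 2 + sn ^ 2 = 1) (hsn : sn ≠ 0)
    (h₁ : (fun V => f₁ (configPerm c V)) = fun V => cs * f₁ V + sn * f₂ V)
    (h₂ : (fun V => f₂ (configPerm c V)) = fun V => -sn * f₁ V + cs * f₂ V) :
    l2 (OpPlat.ins φ (flowLiftAt 0 t f₁)) (OpPlat.ins φ (flowLiftAt 0 t f₁)) =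
      l2 (OpPlat.ins φ (flowLiftAt 0 t f₂)) (OpPlat.ins φ (flowLiftAt 0 t f₂)) :=
  (cov_doublet_eq_zero_and_var_eq β hφ hφ1 heig t hf₁ hf₂ c hrot hsn h₁ h₂).2

end Doublet

/-! ## §3 Clause (o2) for doublet pairs of a lift basis -/

section Clause

/-- **Clause (o2) holds EXACTLY (any `C ≥ 0`) for two channels of a lift basis forming a rotating doublet under some axis permutation** —
in particular for every orthonormal basis of an `E`-doublet of the one-site model: no rotation inside such a degenerate level can violate (o2).
[cite: Luscher1983, §2] -/
theorem liftFamily_o2_of_doublet {L : ℕ} [NeZero L] (β : ℝ) {φ : GaugeConfig 3 L SU2 → ℝ} (hvac : IsRawVacuum β φ)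
    {B : ℝ} {k : ℕ} {ω : GaugeConfig 3 1 SU2 → ℝ} {g : Fin k → (GaugeConfig 3 1 SU2 → ℝ)} (hbasis : LiftBasis B k ω g)
    {C : ℝ} (hC : 0 ≤ C) (i l : Fin k) (c : Equiv.Perm (Fin 3)) {cs sn : ℝ} (hrot : cs ^ 2 + sn ^ 2 = 1) (hsn : sn ≠ 0)
    (h₁ : (fun V => g i (configPerm c V)) = fun V => cs * g i V + sn * g l V)
    (h₂ : (fun V => g l (configPerm c V)) = fun V => -sn * g i V + cs * g l V) :
    |l2 (liftFamily β φ g i) (liftFamily β φ g l)| ≤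
      C * luscherLambda β L *
        (Real.sqrt (l2 (liftFamily β φ g i) (liftFamily β φ g i)) * Real.sqrt (l2 (liftFamily β φ g l) (liftFamily β φ g l))) := by
  obtain ⟨hφ, hφ1, heig⟩ := hvac
  have hg : ∀ j, IsPhys (g j) := hbasis.2.2.2.2.1
  have hzero : l2 (liftFamily β φ g i) (liftFamily β φ g l) = 0 :=
    cov_doublet_eq_zero β hφ hφ1 heig (flowTime β L) (hg i) (hg l) c hrot hsn h₁ h₂
  rw [hzero, abs_zero]
  exact mul_nonneg (mul_nonneg hC (KTRCalibration.luscherLambda_nonneg β L))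
    (mul_nonneg (Real.sqrt_nonneg _) (Real.sqrt_nonneg _))

end Clause

end Summit.QuantumFields.YangMills.Theorems.FemtoTransferGap.PolyakovLift

end
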